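import Literature.AlgebraicGeometry.Crystalline.KaehlerDeRhamComplex
import HarnessLib

/-!
# Naturality of the algebraic de Rham complex in the algebra

For a commutative square of commutative rings `A → B`, `A' → B'`, `A → A'`, `B → B'` (Mathlib idiom,
as for `KaehlerDifferential.map A A' B B'`: instances `[Algebra A A'] [Algebra B B'] [Algebra A B']`
with `[IsScalarTower A A' B'] [IsScalarTower A B B']`), the pull-back of differential forms

* `KaehlerExteriorDerivative.formsMap A A' B B' : ⋀_B Ω[B⁄A] →ₐ[B] ⋀_{B'} Ω[B'⁄A']`
  (`b₀ db₁ ∧ ⋯ ∧ dbₙ ↦ b₀ db₁ ∧ ⋯ ∧ dbₙ` read in `B'`; the exterior-algebra functoriality of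
  Mathlib's `KaehlerDifferential.map A A' B B'`)

commutes with the exterior derivative (`formsMap_extD`: `φ (d x) = d (φ x)`), preserves degrees
(`formsMap_mem_exteriorPower`), and so induces

* `formsMapDegree A A' B B' n : ⋀[B]^n Ω[B⁄A] →ₗ[A] ⋀[B']^n Ω[B'⁄A']` with
  `formsMapDegree (n+1) ∘ d = d ∘ formsMapDegree n` (`formsMapDegree_kaehlerExteriorDerivative`), and,
  over a common base (`A' = A`),
* `deRhamComplexMap A B B' : deRhamComplex A B ⟶ deRhamComplex A B'`, the morphism of algebraic de
  Rham complexes (of cochain complexes of `A`-modules), with `formsMap_self` / `formsMap_formsMap`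
  (functoriality in towers `B → B' → B''` over `A`).

A uniqueness statement (`eq_formsMapDegree_of_ιMulti`) identifies `formsMapDegree n` with ANY
additive, `B`-semilinear map on `n`-forms with the expected values on pure wedges — this is the
bridge to other models of the functoriality of `⋀ⁿ` (e.g. `Motives/HodgeSheaves.exteriorPowerMap'`).

Sources: EGA IV₄ (Publ. IHÉS 32, 1967) 16.6.4 (functoriality of the exterior differential);
The Stacks project, Tag 0FKF (the de Rham complex is functorial in the ring map). [folklore]
Everything is proved; no named facts. NOT here: composition of `formsMap`s for general squares (only
over a common base), base-change isomorphisms, sheafification.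
-/

noncomputable section

namespace Literature.AlgebraicGeometry.Crystalline

open KaehlerDifferential (D)
open ExteriorAlgebra (ι)

universe u v

namespace KaehlerExteriorDerivative

section Square

-- `B` and `B'` live in one universe so that (over a common base) both de Rham complexes are objects of
-- the same category `CochainComplex (ModuleCat.{v} A) ℕ`.
variable (A A' : Type u) (B B' : Type v) [CommRing A] [CommRing A'] [CommRing B] [CommRing B']
  [Algebra A B] [Algebra A' B'] [Algebra A A'] [Algebra A B'] [Algebra B B']
  [IsScalarTower A A' B'] [IsScalarTower A B B']

/-! ### Pull-back of differential forms along `B → B'` -/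

/-- **Pull-back of differential forms** along the `A`-algebra map `B → B'`:
the `B`-algebra map `⋀_B Ω[B⁄A] → ⋀_{B'} Ω[B'⁄A']` extending Mathlib's `KaehlerDifferential.map A A' B B'`
on one-forms (universal property of the exterior algebra), `b₀ db₁ ∧ ⋯ ∧ dbₙ ↦ b₀ db₁ ∧ ⋯ ∧ dbₙ`.
(EGA IV₄ 16.4 / 16.6.4.) [folklore] -/
def formsMap : ExteriorAlgebra B (Ω[B⁄A]) →ₐ[B] ExteriorAlgebra B' (Ω[B'⁄A']) :=
  ExteriorAlgebra.lift B ⟨(ι B').restrictScalars B ∘ₗ KaehlerDifferential.map A A' B B',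
    fun _ ↦ ExteriorAlgebra.ι_sq_zero _⟩

/-- `formsMap` on one-forms is `KaehlerDifferential.map`. [folklore] -/
@[simp] theorem formsMap_ι (ω : Ω[B⁄A]) :
    formsMap A A' B B' (ι B ω) = ι B' (KaehlerDifferential.map A A' B B' ω) :=
  ExteriorAlgebra.lift_ι_apply B _ _ ω

/-- `formsMap (D b) = D b` (read in `B'`). [folklore] -/
theorem formsMap_ι_D (b : B) :
    formsMap A A' B B' (ι B (D A B b)) = ι B' (D A' B' (algebraMap B B' b)) := by
  rw [formsMap_ι, KaehlerDifferential.map_D]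

/-- `formsMap` on functions is the structure map `B → B'`. [folklore] -/
theorem formsMap_algebraMap (b : B) :
    formsMap A A' B B' (algebraMap B _ b) = algebraMap B' _ (algebraMap B B' b) :=
  (formsMap A A' B B').commutes b

/-- `formsMap` commutes with the grading involutions. [folklore] -/
theorem formsMap_involute (x : ExteriorAlgebra B (Ω[B⁄A])) :
    formsMap A A' B B' (CliffordAlgebra.involute x) = CliffordAlgebra.involute (formsMap A A' B B' x) := by
  induction x using ExteriorAlgebra.induction with
  | algebraMap b => rw [AlgHom.commutes, formsMap_algebraMap, AlgHom.commutes]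
  | ι ω => rw [CliffordAlgebra.involute_ι, map_neg, formsMap_ι, CliffordAlgebra.involute_ι]
  | mul x y hx hy => rw [map_mul, map_mul, hx, hy, map_mul, map_mul]
  | add x y hx hy => rw [map_add, map_add, hx, hy, map_add, map_add]

/-- **The exterior derivative is natural**: `φ (d x) = d (φ x)` for the pull-back of forms `φ`
along `B → B'`. (EGA IV₄ 16.6.4; Stacks 0FKF.) [folklore] -/
theorem formsMap_extD (x : ExteriorAlgebra B (Ω[B⁄A])) :
    formsMap A A' B B' (extD A B x) = extD A' B' (formsMap A A' B B' x) := by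
  induction x using ExteriorAlgebra.induction with
  | algebraMap b => rw [extD_algebraMap, formsMap_ι_D, formsMap_algebraMap, extD_algebraMap]
  | ι ω =>
    have hω : ω ∈ Submodule.span B (Set.range (D A B)) := by
      rw [KaehlerDifferential.span_range_derivation]; trivial
    induction hω using Submodule.span_induction with
    | mem x hx => obtain ⟨t, rfl⟩ := hx; rw [extD_ι_D, map_zero, formsMap_ι_D, extD_ι_D]
    | zero => rw [map_zero, map_zero, map_zero, map_zero]
    | add x y _ _ hx hy => rw [map_add, map_add, map_add, hx, hy, map_add, map_add]
    | smul b x _ hx =>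
      rw [extD_ι_smul, map_add, map_mul, formsMap_ι_D, map_smul (formsMap A A' B B') b, hx,
        formsMap_ι A A' B B' x, formsMap_ι A A' B B' (b • x),
        LinearMap.map_smul (KaehlerDifferential.map A A' B B') b x,
        ← IsScalarTower.algebraMap_smul B' b (KaehlerDifferential.map A A' B B' x),
        ← IsScalarTower.algebraMap_smul B' b (extD A' B' _), extD_ι_smul]
  | mul x y hx hy =>
    rw [extD_mul, map_add, map_mul, map_mul, hx, hy, formsMap_involute, map_mul, extD_mul]
  | add x y hx hy => rw [map_add, map_add, hx, hy, map_add, map_add]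

/-- `formsMap` preserves degrees: `x ∈ ⋀ⁿ Ω[B⁄A] → φ x ∈ ⋀ⁿ Ω[B'⁄A']`. [folklore] -/
theorem formsMap_mem_exteriorPower {n : ℕ} {x : ExteriorAlgebra B (Ω[B⁄A])}
    (hx : x ∈ ⋀[B]^n (Ω[B⁄A])) : formsMap A A' B B' x ∈ ⋀[B']^n (Ω[B'⁄A']) := by
  induction hx using Submodule.pow_induction_on_left' with
  | algebraMap b => rw [formsMap_algebraMap]; exact Submodule.algebraMap_mem _
  | add x y i _ _ hx hy => rw [map_add]; exact add_mem hx hy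
  | mem_mul m hm i x _ ih =>
    obtain ⟨ω, rfl⟩ := hm
    rw [map_mul, formsMap_ι]
    simpa only [add_comm 1 i] using SetLike.mul_mem_graded (ι_mem_exteriorPower_one _) ih

/-! ### Degree-wise pull-back and the morphism of de Rham complexes -/

/-- **Pull-back of `n`-forms** along `B → B'`, `⋀ⁿ_B Ω[B⁄A] → ⋀ⁿ_{B'} Ω[B'⁄A']`, as an `A`-linear
map (the degree-`n` part of `formsMap`). [folklore] -/
def formsMapDegree (n : ℕ) : ⋀[B]^n (Ω[B⁄A]) →ₗ[A] ⋀[B']^n (Ω[B'⁄A']) where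
  toFun x := ⟨formsMap A A' B B' x, formsMap_mem_exteriorPower A A' B B' x.2⟩
  map_add' x y := Subtype.ext (map_add (formsMap A A' B B') (x : ExteriorAlgebra B (Ω[B⁄A])) y)
  map_smul' a x := by
    apply Subtype.ext
    change formsMap A A' B B' ((a • x : ⋀[B]^n (Ω[B⁄A])) : ExteriorAlgebra B (Ω[B⁄A])) =
      a • formsMap A A' B B' x
    rw [Submodule.coe_smul_of_tower, ← IsScalarTower.algebraMap_smul B a, map_smul,
      ← IsScalarTower.algebraMap_smul B' (algebraMap A B a), ← IsScalarTower.algebraMap_apply,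
      IsScalarTower.algebraMap_smul]

/-- `formsMapDegree` is `formsMap` on underlying elements. [folklore] -/
@[simp] theorem coe_formsMapDegree (n : ℕ) (x : ⋀[B]^n (Ω[B⁄A])) :
    (formsMapDegree A A' B B' n x : ExteriorAlgebra B' (Ω[B'⁄A'])) = formsMap A A' B B' x := rfl

/-- `formsMapDegree` is `B`-semilinear: `φ (b • x) = b • φ x` (`b` acting on the right through
`B → B'`). [folklore] -/
theorem formsMapDegree_smul (n : ℕ) (b : B) (x : ⋀[B]^n (Ω[B⁄A])) :
    formsMapDegree A A' B B' n (b • x) = algebraMap B B' b • formsMapDegree A A' B B' n x :=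
  Subtype.ext (by
    rw [coe_formsMapDegree, Submodule.coe_smul, map_smul, Submodule.coe_smul, coe_formsMapDegree,
      algebraMap_smul])

/-- `formsMapDegree` on pure wedges: `φ (ω₁ ∧ ⋯ ∧ ωₙ) = φ ω₁ ∧ ⋯ ∧ φ ωₙ`. [folklore] -/
theorem formsMapDegree_ιMulti (n : ℕ) (v : Fin n → Ω[B⁄A]) :
    formsMapDegree A A' B B' n (exteriorPower.ιMulti B n v) =
      exteriorPower.ιMulti B' n (KaehlerDifferential.map A A' B B' ∘ v) := by
  apply Subtype.ext
  rw [coe_formsMapDegree, exteriorPower.ιMulti_apply_coe, exteriorPower.ιMulti_apply_coe,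
    ExteriorAlgebra.ιMulti_apply, ExteriorAlgebra.ιMulti_apply, map_list_prod, List.map_ofFn]
  congr 1
  exact List.ofFn_inj.mpr (funext fun i ↦ formsMap_ι A A' B B' (v i))

/-- **Naturality of the exterior derivative on `n`-forms**: `φ (d x) = d (φ x)`. [folklore] -/
theorem formsMapDegree_kaehlerExteriorDerivative (n : ℕ) (x : ⋀[B]^n (Ω[B⁄A])) :
    formsMapDegree A A' B B' (n + 1) (kaehlerExteriorDerivative A B n x) =
      kaehlerExteriorDerivative A' B' n (formsMapDegree A A' B B' n x) :=
  Subtype.ext (formsMap_extD A A' B B' x)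

/-- Naturality as an identity of additive maps `⋀ⁿ Ω[B⁄A] → ⋀ⁿ⁺¹ Ω[B'⁄A']`. [folklore] -/
theorem formsMapDegree_comp_kaehlerExteriorDerivative_toAddMonoidHom (n : ℕ) :
    (formsMapDegree A A' B B' (n + 1)).toAddMonoidHom.comp
        (kaehlerExteriorDerivative A B n).toAddMonoidHom =
      (kaehlerExteriorDerivative A' B' n).toAddMonoidHom.comp
        (formsMapDegree A A' B B' n).toAddMonoidHom :=
  AddMonoidHom.ext (formsMapDegree_kaehlerExteriorDerivative A A' B B' n)

/-! ### Uniqueness: any semilinear map with the right values on pure wedges is `formsMapDegree` -/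

/-- **Uniqueness of the pull-back on `n`-forms**: an additive map `G : ⋀ⁿ_B Ω[B⁄A] → ⋀ⁿ_{B'} Ω[B'⁄A']`
which is `B`-semilinear and sends `ω₁ ∧ ⋯ ∧ ωₙ` to `φ ω₁ ∧ ⋯ ∧ φ ωₙ` (`φ = KaehlerDifferential.map`)
is `formsMapDegree n` — hence commutes with `d` (`formsMapDegree_kaehlerExteriorDerivative`). This
bridges to other constructions of the functoriality of `⋀ⁿ` (pure wedges span, Mathlib's
`exteriorPower.ιMulti_span`). [folklore] -/
theorem eq_formsMapDegree_of_ιMulti (n : ℕ) (G : ⋀[B]^n (Ω[B⁄A]) →+ ⋀[B']^n (Ω[B'⁄A']))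
    (hs : ∀ (b : B) (x : ⋀[B]^n (Ω[B⁄A])), G (b • x) = algebraMap B B' b • G x)
    (hg : ∀ v : Fin n → Ω[B⁄A], G (exteriorPower.ιMulti B n v) =
      exteriorPower.ιMulti B' n (KaehlerDifferential.map A A' B B' ∘ v))
    (x : ⋀[B]^n (Ω[B⁄A])) : G x = formsMapDegree A A' B B' n x := by
  have hx : x ∈ Submodule.span B (Set.range (exteriorPower.ιMulti B n (M := Ω[B⁄A]))) := by
    rw [exteriorPower.ιMulti_span]; trivial
  induction hx using Submodule.span_induction with
  | mem y hy => obtain ⟨v, rfl⟩ := hy; rw [hg, formsMapDegree_ιMulti]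
  | zero => rw [map_zero, map_zero]
  | add y z _ _ hy hz => rw [map_add, map_add, hy, hz]
  | smul b y _ hy => rw [hs, hy, formsMapDegree_smul]

/-- Consequently such a `G` in degrees `n` and `n + 1` commutes with the exterior derivative.
[folklore] -/
theorem naturality_of_ιMulti (n : ℕ) (G : ⋀[B]^n (Ω[B⁄A]) →+ ⋀[B']^n (Ω[B'⁄A']))
    (G' : ⋀[B]^(n + 1) (Ω[B⁄A]) →+ ⋀[B']^(n + 1) (Ω[B'⁄A']))
    (hs : ∀ (b : B) (x : ⋀[B]^n (Ω[B⁄A])), G (b • x) = algebraMap B B' b • G x)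
    (hg : ∀ v : Fin n → Ω[B⁄A], G (exteriorPower.ιMulti B n v) =
      exteriorPower.ιMulti B' n (KaehlerDifferential.map A A' B B' ∘ v))
    (hs' : ∀ (b : B) (x : ⋀[B]^(n + 1) (Ω[B⁄A])), G' (b • x) = algebraMap B B' b • G' x)
    (hg' : ∀ v : Fin (n + 1) → Ω[B⁄A], G' (exteriorPower.ιMulti B (n + 1) v) =
      exteriorPower.ιMulti B' (n + 1) (KaehlerDifferential.map A A' B B' ∘ v))
    (x : ⋀[B]^n (Ω[B⁄A])) :
    G' (kaehlerExteriorDerivative A B n x) = kaehlerExteriorDerivative A' B' n (G x) := by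
  rw [eq_formsMapDegree_of_ιMulti A A' B B' (n + 1) G' hs' hg', eq_formsMapDegree_of_ιMulti A A' B B' n G hs hg,
    formsMapDegree_kaehlerExteriorDerivative]

end Square

/-! ### Over a common base: functoriality in towers and the morphism of de Rham complexes -/

section CommonBase

variable (A : Type u) (B B' : Type v) [CommRing A] [CommRing B] [CommRing B']
  [Algebra A B] [Algebra A B'] [Algebra B B'] [IsScalarTower A B B']

/-- The pull-back of forms along the identity `B → B` is the identity. [folklore] -/
@[simp] theorem formsMap_self (x : ExteriorAlgebra B (Ω[B⁄A])) : formsMap A A B B x = x := by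
  induction x using ExteriorAlgebra.induction with
  | algebraMap b => rw [formsMap_algebraMap, Algebra.algebraMap_self, RingHom.id_apply]
  | ι ω =>
    rw [formsMap_ι]
    congr 1
    refine LinearMap.congr_fun (LinearMap.ext_on_range (KaehlerDifferential.span_range_derivation A B)
      (f := KaehlerDifferential.map A A B B) (g := LinearMap.id) fun b ↦ ?_) ω
    rw [KaehlerDifferential.map_D, Algebra.algebraMap_self, RingHom.id_apply, LinearMap.id_apply]
  | mul x y hx hy => rw [map_mul, hx, hy]
  | add x y hx hy => rw [map_add, hx, hy]

/-- The pull-back of forms along a composite `B → B' → B''` is the composite of the pull-backs.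
[folklore] -/
theorem formsMap_formsMap (B'' : Type v) [CommRing B''] [Algebra A B''] [Algebra B' B'']
    [Algebra B B''] [IsScalarTower A B' B''] [IsScalarTower A B B''] [IsScalarTower B B' B'']
    (x : ExteriorAlgebra B (Ω[B⁄A])) :
    formsMap A A B' B'' (formsMap A A B B' x) = formsMap A A B B'' x := by
  induction x using ExteriorAlgebra.induction with
  | algebraMap b =>
    rw [formsMap_algebraMap, formsMap_algebraMap, formsMap_algebraMap,
      ← IsScalarTower.algebraMap_apply B B' B'' b]
  | ι ω =>
    rw [formsMap_ι, formsMap_ι, formsMap_ι]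
    congr 1
    refine LinearMap.congr_fun (LinearMap.ext_on_range (KaehlerDifferential.span_range_derivation A B)
      (f := (KaehlerDifferential.map A A B' B'').restrictScalars B ∘ₗ KaehlerDifferential.map A A B B')
      (g := KaehlerDifferential.map A A B B'') fun b ↦ ?_) ω
    rw [LinearMap.comp_apply, LinearMap.restrictScalars_apply, KaehlerDifferential.map_D,
      KaehlerDifferential.map_D, KaehlerDifferential.map_D, ← IsScalarTower.algebraMap_apply B B' B'' b]
  | mul x y hx hy => rw [map_mul, map_mul, hx, hy, map_mul]
  | add x y hx hy => rw [map_add, map_add, hx, hy, map_add]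

/-- Naturality over a common base as an identity of `A`-linear maps. [folklore] -/
theorem formsMapDegree_comp_kaehlerExteriorDerivative (n : ℕ) :
    formsMapDegree A A B B' (n + 1) ∘ₗ kaehlerExteriorDerivative A B n =
      kaehlerExteriorDerivative A B' n ∘ₗ formsMapDegree A A B B' n :=
  LinearMap.ext (formsMapDegree_kaehlerExteriorDerivative A A B B' n)

/-- **The morphism of algebraic de Rham complexes** `Ω•_{B/A} → Ω•_{B'/A}` induced by `B → B'`
(degree-wise `formsMapDegree`; a cochain map by naturality of `d`). (Stacks 0FKF; EGA IV₄ 16.6.4.)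
[folklore] -/
def deRhamComplexMap : deRhamComplex A B ⟶ deRhamComplex A B' :=
  CochainComplex.ofHom (fun n ↦ ModuleCat.ofHom (formsMapDegree A A B B' n)) fun n ↦ by
    rw [deRhamComplex_d, deRhamComplex_d]
    exact ModuleCat.hom_ext (formsMapDegree_comp_kaehlerExteriorDerivative A B B' n).symm

/-- The components of `deRhamComplexMap` are the pull-backs of `n`-forms. [folklore] -/
theorem deRhamComplexMap_f (n : ℕ) :
    (deRhamComplexMap A B B').f n = ModuleCat.ofHom (formsMapDegree A A B B' n) := rfl

end CommonBase

end KaehlerExteriorDerivative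

end Literature.AlgebraicGeometry.Crystalline

end
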